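import Mathlib
import HarnessLib
import Summits.Ventures.LatticeQCDFlow.Scaling.AcceptanceVolumeDecayPi
import Summits.Ventures.LatticeQCDFlow.Scaling.WeightedIntegralInequalities

/-!
# LatticeQCDFlow / Scaling — `ESS ≤ BC²` on a GENERAL space: `(∫p)³ ≤ (∫√(pq))²·∫ p²/q`, so the
# effective sample size of a factorised flow decays at least at the acceptance's exact rate

HONEST FRAMING: exact (Metropolis-corrected) sampling algorithms for lattice gauge theory;
figures of merit are autocorrelation/cost numbers at stated couplings and volumes; no
continuum-physics claim.

Venture `LatticeQCDFlow` (cell pub-lqcd), topic `Scaling`; FANOUT row 3 (`s0-u1-a`, S0-B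
implementation A, GEN-15).  NEW WORK of the cell (elementary), not a published result; NO
definition is introduced.  Theory-2's finite `Scaling/HellingerLength` has `ESS(p,q) ≤ BC(p,q)²`
(`essFrac_le_bhatt_sq`, two Cauchy–Schwarz inequalities on a `Fintype`); here the same law on an
arbitrary measure space `(X, μ)` for a target density `p ≥ 0` and a positive model density `q`,
written on the raw moments (log-convexity of the weight moments `θ ↦ E_q w^θ` along
`θ = 1/2, 1, 2`: `(E_q w)³ ≤ (E_q √w)²·E_q w²`), using row 3's weighted Cauchy–Schwarz
(`Scaling/WeightedIntegralInequalities`, GEN-15, imported) twice — with the Bhattacharyya midpoint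
weight `√(pq)` and with the target weight `p`:

* `integrable_mul_sqrt_div` — `p·√(p/q) ∈ L¹` once `p, p²/q ∈ L¹` (AM–GM domination);
* **`integral_pow_three_le_sq_integral_sqrt_mul_integral_sq_div`** —
  `(∫ p)³ ≤ (∫ √(p q))²·∫ p²/q`;
* **`essFrac_le_sq_integral_sqrt`** — for a normalised target (`∫ p = 1`):
  `1/∫ p²/q ≤ (∫ √(p q))²`, i.e. `ESS ≤ BC²` in the density form of row 3's general-space files;
* **`essFrac_pi_const_le_bhatt_pow`** — `m` identical independent blocks:
  `ESS_m = ESS₁^m ≤ (BC₁²)^m` (with row 3's `essFrac_pi_const`, GEN-12).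

Reading (value-free): with `Scaling/AcceptanceVolumeRatePi` (GEN-15: `acc_m^{1/m} → BC₁²`) and the
`(8/9)·ESS_m ≤ acc_m` floor, the three per-block rates of a factorised flow are ORDERED:
`log(1/ESS₁) ≥ log(1/BC₁²) = lim (1/m) log(1/acc_m)`, i.e. the effective sample size decays at
least as fast as the acceptance, on any configuration space.  NOT CLAIMED: the equality case
(hit-or-miss); any value of ours; nothing re-scored.
-/

namespace Summit.Ventures.LatticeQCDFlow.Theory2

open MeasureTheory Finset Filter

variable {X : Type*} [MeasurableSpace X] {μ : Measure X}

/-- `p·√(p/q)` is integrable once `p` and `p²/q` are (`√(p/q) ≤ (1 + p/q)/2`). [folklore] -/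
theorem integrable_mul_sqrt_div {p q : X → ℝ} (hp0 : ∀ a, 0 ≤ p a) (hpm : Measurable p)
    (hpi : Integrable p μ) (hq0 : ∀ a, 0 < q a) (hqm : Measurable q)
    (h2 : Integrable (fun a => p a ^ 2 / q a) μ) :
    Integrable (fun a => p a * Real.sqrt (p a / q a)) μ := by
  refine (hpi.add h2).mono' (hpm.mul (hpm.div hqm).sqrt).aestronglyMeasurable
    (Eventually.of_forall fun a => ?_)
  rw [Real.norm_of_nonneg (mul_nonneg (hp0 a) (Real.sqrt_nonneg _))]
  have hw : 0 ≤ p a / q a := div_nonneg (hp0 a) (hq0 a).le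
  have hs : Real.sqrt (p a / q a) ≤ 1 + p a / q a := by
    nlinarith [Real.sq_sqrt hw, Real.sqrt_nonneg (p a / q a), sq_nonneg (Real.sqrt (p a / q a) - 1)]
  calc p a * Real.sqrt (p a / q a) ≤ p a * (1 + p a / q a) := mul_le_mul_of_nonneg_left hs (hp0 a)
    _ = p a + p a ^ 2 / q a := by rw [sq]; ring

/-- **`(∫ p)³ ≤ (∫ √(pq))²·∫ p²/q`** for a density `p ≥ 0` and a positive density `q` on any measure
space (two weighted Cauchy–Schwarz inequalities: `(∫p)² = (∫√(pq)·√(p/q))² ≤ (∫√(pq))·∫ p√(p/q)`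
and `(∫ p√(p/q))² ≤ (∫p)·∫ p²/q`). [ours] -/
theorem integral_pow_three_le_sq_integral_sqrt_mul_integral_sq_div {p q : X → ℝ}
    (hp0 : ∀ a, 0 ≤ p a) (hpm : Measurable p) (hpi : Integrable p μ) (hq0 : ∀ a, 0 < q a)
    (hqm : Measurable q) (hqi : Integrable q μ) (h2 : Integrable (fun a => p a ^ 2 / q a) μ) :
    (∫ a, p a ∂μ) ^ 3 ≤ (∫ a, Real.sqrt (p a * q a) ∂μ) ^ 2 * ∫ a, p a ^ 2 / q a ∂μ := by
  set P := ∫ a, p a ∂μ with hP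
  set B := ∫ a, Real.sqrt (p a * q a) ∂μ with hB
  set M := ∫ a, p a * Real.sqrt (p a / q a) ∂μ with hM
  set Q := ∫ a, p a ^ 2 / q a ∂μ with hQ
  have hk0 : ∀ a, 0 ≤ Real.sqrt (p a * q a) := fun a => Real.sqrt_nonneg _
  have hki : Integrable (fun a => Real.sqrt (p a * q a)) μ :=
    integrable_sqrt_mul hp0 hpm hpi (fun a => (hq0 a).le) hqm hqi
  have hTm : Measurable fun a => Real.sqrt (p a / q a) := (hpm.div hqm).sqrt
  have hT0 : ∀ a, 0 ≤ Real.sqrt (p a / q a) := fun a => Real.sqrt_nonneg _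
  have hMi := integrable_mul_sqrt_div hp0 hpm hpi hq0 hqm h2
  -- pointwise: `√(pq)·√(p/q) = p`, `√(pq)·(√(p/q))² = p·√(p/q)`, `p·(√(p/q))² = p²/q`
  have e1 : ∀ a, Real.sqrt (p a * q a) * Real.sqrt (p a / q a) = p a := by
    intro a
    rw [← Real.sqrt_mul (mul_nonneg (hp0 a) (hq0 a).le), show p a * q a * (p a / q a) = p a ^ 2 by
      rw [mul_assoc, mul_div_cancel₀ _ (hq0 a).ne', sq], Real.sqrt_sq (hp0 a)]
  have e2 : ∀ a, Real.sqrt (p a * q a) * Real.sqrt (p a / q a) ^ 2 = p a * Real.sqrt (p a / q a) := by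
    intro a
    rw [sq, ← mul_assoc, e1 a]
  have e3 : ∀ a, p a * Real.sqrt (p a / q a) ^ 2 = p a ^ 2 / q a := by
    intro a
    rw [Real.sq_sqrt (div_nonneg (hp0 a) (hq0 a).le), sq, mul_div_assoc]
  -- first Cauchy–Schwarz, weight `√(pq)`
  have hKT2 : Integrable (fun a => Real.sqrt (p a * q a) * Real.sqrt (p a / q a) ^ 2) μ := by
    simp_rw [e2]; exact hMi
  have h1 := sq_integral_mul_abs_le hk0 hki hTm hKT2
  simp_rw [abs_of_nonneg (hT0 _), e1, e2] at h1
  -- second Cauchy–Schwarz, weight `p`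
  have hKT2' : Integrable (fun a => p a * Real.sqrt (p a / q a) ^ 2) μ := by
    simp_rw [e3]; exact h2
  have h2' := sq_integral_mul_abs_le hp0 hpi hTm hKT2'
  simp_rw [abs_of_nonneg (hT0 _), e3] at h2'
  -- combine: `P⁴ ≤ B² M² ≤ B² P Q`
  have hP0 : 0 ≤ P := integral_nonneg hp0
  have hB0 : 0 ≤ B := integral_nonneg hk0
  have hQ0 : 0 ≤ Q := integral_nonneg fun a => div_nonneg (sq_nonneg _) (hq0 a).le
  have h4 : P ^ 4 ≤ B ^ 2 * (P * Q) := by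
    calc P ^ 4 = (P ^ 2) ^ 2 := by ring
      _ ≤ (B * M) ^ 2 := pow_le_pow_left₀ (sq_nonneg _) h1 2
      _ = B ^ 2 * M ^ 2 := by ring
      _ ≤ B ^ 2 * (P * Q) := mul_le_mul_of_nonneg_left h2' (sq_nonneg _)
  rcases hP0.eq_or_lt with hP' | hP'
  · rw [← hP']; simpa using mul_nonneg (sq_nonneg B) hQ0
  · have : P ^ 3 * P ≤ B ^ 2 * Q * P := by nlinarith [h4]
    exact le_of_mul_le_mul_right this hP'

/-- **`ESS ≤ BC²` ON A GENERAL SPACE.**  For a normalised target density `p ≥ 0` (`∫ p = 1`) and a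
positive model density `q` with `∫ p²/q < ∞`: `(∫p)²/∫ p²/q ≤ (∫ √(pq))²`, i.e. the effective
sample size fraction is at most the squared Bhattacharyya affinity. [ours] -/
theorem essFrac_le_sq_integral_sqrt {p q : X → ℝ} (hp0 : ∀ a, 0 ≤ p a) (hpm : Measurable p)
    (hpi : Integrable p μ) (hp1 : ∫ a, p a ∂μ = 1) (hq0 : ∀ a, 0 < q a) (hqm : Measurable q)
    (hqi : Integrable q μ) (h2 : Integrable (fun a => p a ^ 2 / q a) μ) :
    (∫ a, p a ∂μ) ^ 2 / ∫ a, p a ^ 2 / q a ∂μ ≤ (∫ a, Real.sqrt (p a * q a) ∂μ) ^ 2 := by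
  have h := integral_pow_three_le_sq_integral_sqrt_mul_integral_sq_div hp0 hpm hpi hq0 hqm hqi h2
  rw [hp1, one_pow] at h ⊢
  have hQ0 : 0 ≤ ∫ a, p a ^ 2 / q a ∂μ := integral_nonneg fun a => div_nonneg (sq_nonneg _) (hq0 a).le
  rcases hQ0.eq_or_lt with hQ | hQ
  · rw [← hQ, div_zero]; exact sq_nonneg _
  · rwa [div_le_iff₀ hQ]

/-- **`ESS_m ≤ (BC₁²)^m` for `m` identical independent blocks on a general space** — the effective
sample size of a factorised flow decays at least at the Bhattacharyya rate, which by
`Scaling/AcceptanceVolumeRatePi` is the EXACT rate of its acceptance. [ours] -/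
theorem essFrac_pi_const_le_bhatt_pow {ι : Type*} [Fintype ι] {Y : Type*} [MeasurableSpace Y]
    {ν : Measure Y} [SigmaFinite ν] {p q : Y → ℝ} (hp0 : ∀ a, 0 ≤ p a) (hpm : Measurable p)
    (hpi : Integrable p ν) (hp1 : ∫ a, p a ∂ν = 1) (hq0 : ∀ a, 0 < q a) (hqm : Measurable q)
    (hqi : Integrable q ν) (h2 : Integrable (fun a => p a ^ 2 / q a) ν) :
    (∫ x, ∏ i : ι, p (x i) ∂(Measure.pi fun _ : ι => ν)) ^ 2
        / ∫ x, (∏ i : ι, p (x i)) ^ 2 / ∏ i : ι, q (x i) ∂(Measure.pi fun _ : ι => ν)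
      ≤ ((∫ a, Real.sqrt (p a * q a) ∂ν) ^ 2) ^ Fintype.card ι := by
  rw [essFrac_pi_const (ι := ι) (ν := ν) p q]
  exact pow_le_pow_left₀ (div_nonneg (sq_nonneg _)
    (integral_nonneg fun a => div_nonneg (sq_nonneg _) (hq0 a).le))
    (essFrac_le_sq_integral_sqrt hp0 hpm hpi hp1 hq0 hqm hqi h2) _

end Summit.Ventures.LatticeQCDFlow.Theory2
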